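import Literature.AnabelianGeometry.SemiGraphs.TemperedAnabelianThm68Sub

/-!
# [SemiAnbd] Thm. 6.8 sub-DAG: two edges PROVED — "enlarging the base field" from compactness + Thm. 6.5 (ii) (T68iv-L01 ⇐ B1), and torsion ⇒ tempered `DLoc`-type (T68iii-L05 ⇐ L04)

Mochizuki, *Semi-graphs of anabelioids* [SemiAnbd], §6 Thm. 6.8 (iii)/(iv), kurims p. 75; the steps
are [Mzk8] (*Galois sections in absolute anabelian geometry*) proof of Cor. 2.8, p. 11 l. 3–4 ("by
Theorem 1.3, (ii), we may always enlarge `K`, `L`") and proof of Cor. 2.6, p. 10 ("exhibits the closed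
points … that arise from `n`-torsion points … as closed points of `DLoc`-type").
[cite: MochizukiSemiAnbd2006, Thm 6.8 pp.74-75] [cite: MochizukiGalSect2005, §2 pp.10-11]

Proof-only companion (abc-iut cell, layer L3, seat abc-iut-w5-d040) to `TemperedAnabelianThm68Sub.lean`
(plan/L3/SUBDAG-SemiAnbd-Thm68.md):
* `Thm68Sub.decompRecovered_of_compact : DecompCompact X → X.DecompCommensurablyTerminal →
  DecompRecoveredFromOpenSubgroup X` — an open subgroup of the compact group `D_x` has finite index
  (Mathlib `Subgroup.quotient_finite_of_isOpen`), then `decompRecovered_of`;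
* `Thm68Sub.torsionIsTemperedDLocType_of : TorsionIffMulNCuspImage X D a → TorsionIsTemperedDLocType
  X D a` — the witness of T68iii-L04 is a witness of Def. 6.7 (`TemperedCurve.IsTemperedDLocType`).
Pure bookkeeping over the FROZEN interfaces; nothing of [SemiAnbd]/[Mzk8] is asserted; nothing here
takes a side on [IUTchIII] Cor. 3.12.
-/

noncomputable section

namespace Literature.AnabelianGeometry.SemiGraphs

open scoped Pointwise
open CategoryTheory Topology

variable {p : ℕ} [Fact p.Prime]

namespace Thm68Sub

/-- In a compact decomposition group, the trace of an open subgroup of `Π^temp_{X_K}` has finite index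
(the tacit step "an open subgroup of `D_x` has finite index", T68-B1). [cite: MochizukiGalSect2005, Cor 2.5 p.9] -/
theorem finiteIndex_decomp_inf_of_compact {X : TemperedCurve p} (hc : DecompCompact X) (x : X.Pt)
    (U : Subgroup X.PiTemp) (hU : IsOpen (U : Set X.PiTemp)) :
    ((X.decomp x ⊓ U).subgroupOf (X.decomp x)).FiniteIndex := by
  haveI : CompactSpace (X.decomp x) := isCompact_iff_compactSpace.1 (hc x)
  have hopen : IsOpen (((X.decomp x ⊓ U).subgroupOf (X.decomp x) : Subgroup (X.decomp x)) :
      Set (X.decomp x)) := by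
    have : (((X.decomp x ⊓ U).subgroupOf (X.decomp x) : Subgroup (X.decomp x)) : Set (X.decomp x)) =
        Subtype.val ⁻¹' (U : Set X.PiTemp) := by
      ext ⟨g, hg⟩
      simp [Subgroup.mem_subgroupOf]
    rw [this]
    exact hU.preimage continuous_subtype_val
  haveI := Subgroup.quotient_finite_of_isOpen _ hopen
  exact Subgroup.finiteIndex_of_finite_quotient

/-- **T68iv-L01 ⇐ T68-B1 + Thm. 6.5 (ii) (PROVED)**: decomposition groups over `K` are recovered from
their intersections with any open subgroup of finite index (e.g. `Π^temp_{X_{K'}}`) as commensurators —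
[Mzk8] proof of Cor. 2.8, p. 11 l. 3–4 "by Theorem 1.3, (ii), we may always enlarge `K`, `L`".
[cite: MochizukiGalSect2005, Cor 2.8 p.11] -/
theorem decompRecovered_of_compact (X : TemperedCurve p) (hc : DecompCompact X)
    (hct : X.DecompCommensurablyTerminal) : DecompRecoveredFromOpenSubgroup X :=
  decompRecovered_of X hct fun x U hU _ => finiteIndex_decomp_inf_of_compact hc x U hU

/-- **T68iii-L05 ⇐ T68iii-L04 (PROVED)**: a torsion closed point of a once-punctured elliptic curve is
of tempered `DLoc`-type (Def. 6.7) — the `[n]`-object witness of [Mzk8] p. 10 is a Def. 6.7 witness.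
[cite: MochizukiGalSect2005, Cor 2.6 p.10] -/
theorem torsionIsTemperedDLocType_of (X : TemperedCurve p) (D : DLocSchemeData X)
    (a : TemperedCurve.CurveArithmeticFlags X) (h : TorsionIffMulNCuspImage X D a) :
    TorsionIsTemperedDLocType X D a := by
  intro hE x hx
  obtain ⟨n, -, Zn, ψ, -, -, Dz, γ, hDz, hle, hopen⟩ := (h hE x).1 (Or.inl hx)
  exact ⟨Zn, ψ, Dz, γ, hDz, hle, hopen⟩

end Thm68Sub

end Literature.AnabelianGeometry.SemiGraphs

end
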